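import Mathlib
import Summits.Ventures.HodgeRepro.Tier4.Target
import Summits.Ventures.HodgeRepro.Tier4.Line3.KMDatum
import Summits.Ventures.HodgeRepro.Tier4.Line3.KMDatumS
import Summits.Ventures.HodgeRepro.Tier4.Line3.Defs
import Summits.Ventures.HodgeRepro.Tier4.Line3.LocaliserS

/-!
# Tier4/Line3/HasLocaliser — the displayed printed input of L3.3 and the Hecke-localisability Prop, verbatim (v0.25)

Blind re-derivation cell `pub-hodge-repro`, Tier 4 «PROVE THE STEP» (README §9–§10).  Line L3 (planner t4-plan-3):
`Tier4/Line3/Skeleton.lean` v0.25, sha256 ec1fcd926e78d4dc975871689e93799df79abdb87f1cecc43272ceb4926ecf88, 1320 lines («LINE L3 FILED» S12585).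
Filed by t4-L3-p2 on the lead's ask (S12585: «Defs/Localiser regeneration for `HasLocaliser` / `IsHeckeLocalisable`»):
the three `def`s `T4Data.HasLocaliser` (the printed half of L3.3: a deep-level localiser around ONE symmetric
`J`-positive lattice tuple — tuple EXISTENTIAL since v0.25, the O6 repair), `T4Data.IsHeckeLocalisable` (the same with
the Euler-product clause; the conclusion of the wall item `euler_nonvanishing`) and `T4Data.PrintedIdentification`
(L3.0 + the printed localiser as ONE named Prop, the hypothesis `hlit` of `target_L3`), BYTE-IDENTICAL to the skeleton
(v0.25 L943–L1014) with the skeleton's own docstrings, in the same namespace, up to the tree's names for the localiser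
interfaces: the skeleton's `X.Loc` / `X.LocE` (its inline copies of the v0.24 interface) read `X.LocS` / `X.LocES`
(`Tier4/Line3/LocaliserS.lean`, p666956) on code lines — the `KMDatumS` / `LocaliserS` precedent.

Nothing here says anything about the status of the Hodge conjecture for CM abelian varieties, which is NOT proved
(HC_CM is NOT proved by anyone in this repository).
-/

set_option autoImplicit false

noncomputable section

namespace Summit.Ventures.HodgeRepro.Tier4.Line3

open Summit.Ventures.HodgeRepro.Tier4
open Matrix MeasureTheory NumberField
open Filter Topology
open scoped ComplexConjugate ComplexOrder

open scoped Classical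

namespace T4Data

variable (X : T4Data)

/-- **THE PRINTED HALF OF L3.3 (v0.25 = the REPAIRED form of v0.20–v0.24; lead ruling (B) S12473): a DEEP-LEVEL
LOCALISER EXISTS AROUND ONE SYMMETRIC `J`-POSITIVE LATTICE TUPLE** — at some prime `𝔭`, for SOME lattice tuple
`xm = (a, b, a, b) ∈ L₀⁴` with independent first ball coordinates spanning a `J`-positive plane, a localiser `Loc`
(support in the two-sided depth-`N` ball, normalisation `1` at `xm`, polynomial growth with Gaussian decay at the
definite places, level `⊇ Γ ∩ Γ(q₀^N)`).
WHY THE TUPLE IS EXISTENTIAL (v0.25 REPAIR, t4-plan-3 2026-08-28): v0.20–v0.24 quantified `∀ L₀, ∀ xm ∈ L₀⁴`, and THAT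
is FALSE for EVERY `D`: `coefQ (loc N) xm` is a sum of products of `(h · cf_j)(xm_j)`, `(h · c)(x) = Σ n Σ_r c(r x)`
with `r ∈ U(H)(E′)` (`HeckeElement.IsFor`: unitary double cosets), and `cf_j` vanishes off the torus-saturation of
FINITELY MANY lattices `L ∈ S` (`ThetaData.support`); so `(h · cf_j)(xm_j) ≠ 0` forces `H(xm_j, xm_j) = H(t r xm_j,
t r xm_j) ∈ 𝔞 := Σ_{L ∈ S} H(L, L)`, a finitely generated `𝒪`-submodule of `E′` (bounded denominators).  The tuple
`ℓ^{-k} · xm` is still symmetric, `J`-positive and a lattice tuple (of `ℓ^{-k} L₀`), but `H(xm_0, xm_0) / ℓ^{2k} ∉ 𝔞`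
for `k` large (`H(xm_0, xm_0) ≠ 0` by positivity), so `main_one` is impossible there and `Loc D p (ℓ^{-k} L₀) (ℓ^{-k} xm)`
is EMPTY.  Hence the localiser can only be asserted around tuples in the JOINT SUPPORT of the four (translated)
coefficient systems, and the displayed input asserts ONE such tuple, which the construction CHOOSES.
WHAT IS PRINTED AND WHAT IS THE CELL'S: the local cyclicity (P1)+(P2) Zelevinsky 1980 Thm 9.7 at a split `𝔭` +
type-II Howe duality (rows I-t4-lit-5-28/29), Liu 2021 Lemma D.1 + Bump Prop 4.2.3 at EVERY place (rows I-t4-lit-5-51/53: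
the slot-wise torus-isotypic piece is irreducible, so `[φ_{j,v}]` generates it over the Hecke algebra and a localised
indicator is a Hecke translate) and strong approximation for `SU(V)` (Getz–Hahn Thm 2.5.6, S12513) are PRINTED; the
CHOICE of `(a, b)`: symmetric, `J`-positive at `τ₀` (L3.3a gives them in every lattice, densely) AND in the joint
support of the four translated coefficient systems after a fixed Hecke translate at the bad places (t4-lit-5's option
(ii), S12485 — weak approximation for `(a, b)` against the finitely many bad-place conditions), with the normalisation
`main_one` — is the CELL'S CONSTRUCTION, not in print in this form (marked as the seat's; a prover cannot reach it from
the abstract `ThetaData`, whose `cf` is not known to be a theta lift).  An abstract `D` off the genuine one (`cf + k`,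
`k` in the kernel of the theta map — addendum §2(b)) is simply one for which it FAILS: a displayed hypothesis, not a
field. -/
def HasLocaliser (D : X.ThetaData) : Prop :=
  ∃ (p : IsDedekindDomain.HeightOneSpectrum (NumberField.RingOfIntegers X.E))
    (L₀ : Submodule (NumberField.RingOfIntegers X.E) (Fin 3 → X.E)) (xm : X.Tuple),
    X.IsLattice L₀ ∧ (∀ j, xm j ∈ L₀) ∧ xm 2 = xm 0 ∧ xm 3 = xm 1 ∧
    X.ballCoord (xm 0) 0 * X.ballCoord (xm 1) 1 - X.ballCoord (xm 0) 1 * X.ballCoord (xm 1) 0 ≠ 0 ∧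
    (∀ u v : ℂ, (u ≠ 0 ∨ v ≠ 0) →
      0 < (star (u • X.ballCoord (xm 0) + v • X.ballCoord (xm 1)) ⬝ᵥ
        (J *ᵥ (u • X.ballCoord (xm 0) + v • X.ballCoord (xm 1)))).re) ∧
    Nonempty (X.LocS D p L₀ xm)

/-- HECKE LOCALISABILITY WITH THE EULER PRODUCT (v0.20; tuple existential since v0.25 as in `HasLocaliser`): around SOME
symmetric `J`-positive lattice tuple a deep-level localiser `LocE` — `Loc` plus the clause `euler` (the class sums of the
main orbit converge to a NON-ZERO limit).  The conclusion of the wall item `euler_nonvanishing` (L3.3e) and the input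
of L3.3b. -/
def IsHeckeLocalisable (D : X.ThetaData) : Prop :=
  ∃ (p : IsDedekindDomain.HeightOneSpectrum (NumberField.RingOfIntegers X.E))
    (L₀ : Submodule (NumberField.RingOfIntegers X.E) (Fin 3 → X.E)) (xm : X.Tuple),
    X.IsLattice L₀ ∧ (∀ j, xm j ∈ L₀) ∧ xm 2 = xm 0 ∧ xm 3 = xm 1 ∧
    X.ballCoord (xm 0) 0 * X.ballCoord (xm 1) 1 - X.ballCoord (xm 0) 1 * X.ballCoord (xm 1) 0 ≠ 0 ∧
    (∀ u v : ℂ, (u ≠ 0 ∨ v ≠ 0) →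
      0 < (star (u • X.ballCoord (xm 0) + v • X.ballCoord (xm 1)) ⬝ᵥ
        (J *ᵥ (u • X.ballCoord (xm 0) + v • X.ballCoord (xm 1)))).re) ∧
    Nonempty (X.LocES D p L₀ xm)

/-- **L3.0 + THE PRINTED LOCALISER, DISPLAYED (v0.24, lead S12511): the PRINTED INPUT of the identification side, as ONE
named Prop consumed by `target_L3` as a hypothesis (as L4 displays its Borel–Harish-Chandra inputs).** «The coefficient
system identifying the four corners exists and is Hecke-localisable.»  THE IDENTIFICATION (L3.0): The four eigen-`(1,0)`-forms `(a_i)^* dz_σ` of the corners are theta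
lifts from `U(1)` of Hecke characters with the holomorphic Kudla–Millson archimedean datum: Liu 2021 (CJM 9) Prop 4.13
proof, Case 1, print p. 48 L19–L56 (`π = Θ^{−W}(π_W)`, `π_∞ ≃ ω_{2,1}^{m₁,±,1} ⊗ ⊗ ω_{3,0}^{m_i,±,1}`), Lemma D.2(2)
print p. 127 L48–60 (the `(1,0)`-cohomological representation is `ω(μ_{−1}, −i, 1)`; erratum I-t4-lit-5-E5), BMM16 Cor
65; the Schwartz-form shape: Bergeron, Produit, §3 Thm 3.3/3.4 and the Fock → Schrödinger dictionary (rows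
I-t4-lit-5-34/35), Kudla–Millson IHÉS 71 p. 124 (row 37); `ω(h)φ(x) = φ(h⁻¹x)` (Kudla notes, row 32) gives `equiv`; the
coefficient function `c = ∫_{U(1)(𝔸_f)} μ_f(t) φ_f(x t) dt` restricted to `V(E′)` gives `invΓ`, `weight`, `support`
(the finiteness of `U(1)(𝔸_f)/U(1)(E′)U(1)(Ô)`).  Its statement is an existence of data with displayed properties; it
carries no non-vanishing.
THE LOCALISER: `HasLocaliser` above (rows I-t4-lit-5-28/29/51/53 + strong approximation, Getz–Hahn Thm 2.5.6 row
t4-lit-5 S12513, with the pure-tensor model bookkeeping of S12515 marked as the seat's).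
THE MODEL PASSAGE (row I-t4-lit-5-55, Bergeron [Produit] §1 p0003:L51–L67; plan-3 S12546): the PRINTED classes are
theta series `Σ_{x ∈ X(k₀)}` in the Schrödinger model `L²(X(𝔸))` of the pair `(U(V), U(W₊))`, `X` a 3-dimensional
`E⁺`-Lagrangian of `Res(V ⊗ W₊)`; `ThetaData.theta` is the `S(V(𝔸))`-side theta function (the doubled pair
`(U(V), U(W₊ ⊕ W₋))`, Lagrangian `V ⊗ e`) at the ∂-coordinates.  The two are related by the STANDARD change of
polarisation of the Weil representation (a partial Fourier transform intertwining the two Schrödinger models — a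
theorem of the Weil representation, not of this cell; page-exact row requested) followed by the seesaw restriction of
row 54 to `U(V) × (U(W₊) × U(W₋))` on a pure tensor with the `W₋`-slot fixed.  So this displayed Prop is printed UP TO
that change of polarisation, the cell's pure-tensor bookkeeping and the cell's CHOICE of the localised tuple
(`HasLocaliser`, v0.25) — it is labelled so, and nothing in it is a non-vanishing of `(P)`. -/
def PrintedIdentification : Prop := ∃ D : X.ThetaData, X.HasLocaliser D

end T4Data

end Summit.Ventures.HodgeRepro.Tier4.Line3

end
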